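import Literature.AlgebraicGeometry.HodgeTheory.HomComplexDualTranspose
import Mathlib.Algebra.Homology.DerivedCategory.Basic
import Mathlib.CategoryTheory.HomCongr
import HarnessLib

/-!
# Derived duality for bounded vector-bundle complexes, REDUCED to the derived unit adjunction (ROAD K: (β3) ⟸ A-side + brick B)

Layer `Literature/AlgebraicGeometry/HodgeTheory`; sequel to `HomComplexDualTranspose.lean` (brick **B**:
`nonempty_homComplex_dualComplexUnit_transposeIso : Nonempty (𝓗om•(F•^∨, E•^∨) ≅ 𝓗om•(E•, F•))`, `(–)^∨ := 𝓗om•(–, 𝒪_X[0])`, for complexes with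
finite locally free terms). ROAD K for the derived duality `Hom_D(Q F•^∨, (Q E•^∨)⟦k⟧) ≃ Hom_D(Q E•, (Q F•)⟦k⟧)` writes it as
`A(F•^∨, E•^∨) ∘ B ∘ A(E•, F•)⁻¹`, where **A** is the DERIVED UNIT ADJUNCTION for a strictly perfect source,
`A(M•, N•) : Hom_D(Q M•, (Q N•)⟦k⟧) ≃ Hom_D(Q 𝒪[0], (Q 𝓗om•(M•, N•))⟦k⟧)` (not in this file). This file is the SOCKET:

* `HomComplex.shiftedHomCongrRight` — an isomorphism of complexes `L• ≅ L'•` gives `Hom_D(T, (Q L•)⟦k⟧) ≃ Hom_D(T, (Q L'•)⟦k⟧)`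
  (`Iso.homCongr` with `Q.mapIso`, `shiftFunctor`);
* **`nonempty_shiftedHom_dualComplexUnit_equiv_of_unitAdjunction`** — given the two unit-adjunction bijections `A(E•, F•)` and `A(F•^∨, E•^∨)`
  AS ARGUMENTS (plain `Equiv`s, no `Prop` placeholder), the derived duality bijection
  `Nonempty (Hom_D(Q F•^∨, (Q E•^∨)⟦k⟧) ≃ Hom_D(Q E•, (Q F•)⟦k⟧))` follows for `E•`, `F•` with finite locally free terms — brick B enters through
  `Q.mapIso`; no naturality is used.

Everything is proved; 0 named facts; any `HasDerivedCategory` instance. What is NOT here: the A-side itself (the tree has the one-term case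
`DerivedTensorHomAdjunction.shiftedHomLinearEquivSingleHomComplex`; the general bounded case is its (A4) brick). Use (Hodge programme, road №4,
crux 26512, item (β3)): the final `nonempty_shiftedHom_dualComplexUnit_equiv` is this socket applied to the A-side's
`HomComplex.shiftedHomEquivUnit` at `(E•, F•)` and at `(F•^∨, E•^∨)` (the latter strictly perfect by
`HomComplex.isFiniteLocallyFree_dualComplexUnit_X` ∕ `isStrictlyGE/LE_dualComplexUnit`). Nothing of that crux is asserted here.

## References

* R. Hartshorne, *Algebraic Geometry* (1977), II Ex. 5.1 (b), III.6 (Ext and 𝓗om). [Hartshorne1977]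
* C. A. Weibel, *An introduction to homological algebra* (1994), §10.4, 2.7.4–2.7.5. [Weibel1994]
-/

noncomputable section

open CategoryTheory CategoryTheory.Limits AlgebraicGeometry Opposite

universe w u

namespace Literature.AlgebraicGeometry.HodgeTheory

open Literature.AlgebraicGeometry.Modules Literature.AlgebraicGeometry.Motives

namespace HomComplex

variable (X : Scheme.{u}) [HasDerivedCategory.{w} X.Modules]

/-- An isomorphism of complexes `e : L• ≅ L'•` induces `Hom_D(T, (Q L•)⟦k⟧) ≃ Hom_D(T, (Q L'•)⟦k⟧)` (post-composition with `(Q e)⟦k⟧`).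
[cite: Weibel1994, §10.4 (the derived category; functoriality of Q)] -/
def shiftedHomCongrRight (T : DerivedCategory X.Modules) {L L' : CochainComplex X.Modules ℤ} (e : L ≅ L') (k : ℤ) :
    ShiftedHom T (DerivedCategory.Q.obj L) k ≃ ShiftedHom T (DerivedCategory.Q.obj L') k :=
  Iso.homCongr (Iso.refl T) ((shiftFunctor (DerivedCategory X.Modules) k).mapIso (DerivedCategory.Q.mapIso e))

/-- `shiftedHomCongrRight` is post-composition with `(Q e.hom)⟦k⟧'`. [cite: Weibel1994, §10.4] -/
theorem shiftedHomCongrRight_apply (T : DerivedCategory X.Modules) {L L' : CochainComplex X.Modules ℤ} (e : L ≅ L') (k : ℤ)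
    (y : ShiftedHom T (DerivedCategory.Q.obj L) k) :
    shiftedHomCongrRight X T e k y = y ≫ (DerivedCategory.Q.map e.hom)⟦k⟧' := by
  simp [shiftedHomCongrRight, Iso.homCongr]

variable (E F : CochainComplex X.Modules ℤ) (k : ℤ)

/-- **DERIVED DUALITY FOR VECTOR-BUNDLE COMPLEXES, FROM THE UNIT ADJUNCTION (ROAD K)**: if `A(E•, F•)` and `A(F•^∨, E•^∨)` are bijections
`Hom_D(Q M•, (Q N•)⟦k⟧) ≃ Hom_D(Q 𝒪[0], (Q 𝓗om•(M•, N•))⟦k⟧)` (the derived unit adjunction — supplied by the caller), then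
`Hom_D(Q F•^∨, (Q E•^∨)⟦k⟧) ≃ Hom_D(Q E•, (Q F•)⟦k⟧)` with `(–)^∨ := 𝓗om•(–, 𝒪_X[0])`, for `E•`, `F•` with finite locally free terms:
`A(F•^∨, E•^∨)`, then brick B (`nonempty_homComplex_dualComplexUnit_transposeIso`) through `Q`, then `A(E•, F•)⁻¹`.
[cite: Hartshorne1977, II Ex. 5.1 (b) and III.6] [cite: Weibel1994, §10.4 and 2.7.4–2.7.5] -/
theorem nonempty_shiftedHom_dualComplexUnit_equiv_of_unitAdjunction
    (hE : ∀ i, IsFiniteLocallyFree (E.X i)) (hF : ∀ i, IsFiniteLocallyFree (F.X i))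
    (A₁ : ShiftedHom (DerivedCategory.Q.obj E) (DerivedCategory.Q.obj F) k ≃
      ShiftedHom (DerivedCategory.Q.obj (single₀ X (unitModule X))) (DerivedCategory.Q.obj (homComplex X E F)) k)
    (A₂ : ShiftedHom (DerivedCategory.Q.obj (homComplex X F (single₀ X (unitModule X))))
        (DerivedCategory.Q.obj (homComplex X E (single₀ X (unitModule X)))) k ≃
      ShiftedHom (DerivedCategory.Q.obj (single₀ X (unitModule X)))
        (DerivedCategory.Q.obj (homComplex X (homComplex X F (single₀ X (unitModule X))) (homComplex X E (single₀ X (unitModule X))))) k) :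
    Nonempty (ShiftedHom (DerivedCategory.Q.obj (homComplex X F (single₀ X (unitModule X))))
        (DerivedCategory.Q.obj (homComplex X E (single₀ X (unitModule X)))) k ≃
      ShiftedHom (DerivedCategory.Q.obj E) (DerivedCategory.Q.obj F) k) :=
  ⟨A₂.trans ((shiftedHomCongrRight X _ (dualTransposeIso X F E hE hF) k).trans A₁.symm)⟩

end HomComplex

end Literature.AlgebraicGeometry.HodgeTheory

end
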